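import Summits.BirchSwinnertonDyer.BirchSwinnertonDyer.Theorems.ByReductionTypeAtTwoTowerFiltrationDuality
import HarnessLib

/-!
# The MODULE-FILTRATION certificate, part 2: ONE layer sees `#X/(p, T^m)X` for every `m ≤ pⁿ`, with Greenberg's
# local error terms on the filtered pieces (route ByReductionTypeAtTwo, crux `MultUpperHalfAtTwo`, item
# stmt-BirchSwinnertonDyer-19922; seat bsd-2adic-mult-2 GEN 9, part 2 of 3)

HONEST FRAMING (cell `bsd-2adic`, run/shared/lean/pub/bsd-2adic/, HUMAN RULINGS D-0036/D-0054/D-0074): THEOREMS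
ONLY; nothing asserted; no definition; no new named fact; closes nothing by itself; BSD is not proved by any
of this. PARTITION: X5@2 mult (K4ᵐ, B1·O1) × p = 2 — types-the-object-of (a sharper per-class certificate
format for item 19922 AT the class); closes none. bears_on: K4 (route-BirchSwinnertonDyer-ByReductionTypeAtTwo
item 19922).

Part 1 (`…TowerFiltrationDuality`) proved `#X/(p,T^m)X = #{s ∈ Sel_∞[p] : (conj_γ−1)^m s = 0}` and that such
classes are fixed by `conj_{γ^{pⁿ}}` for `m ≤ pⁿ`. This part moves to the layer `K_n` (`E(K)[p] = 0`, `γ` a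
topological generator), with `ν = conj_γ − id` acting on `H¹(K_n, E[p^∞])` (restriction `h_n` intertwines it,
`layerToInfty_iterate_conjSubId`):
* **`natCard_quotient_towerIdeal_eq_natCard_layerFiltration`: `#X/(p,T^m)X = #{z ∈ A_n[p] : ν^[m] z = 0}`**,
  `A_n = h_n⁻¹(Sel_∞)`, `m ≤ pⁿ` (`h_n` injective, the tree's sharp Lemma 3.2 for the range);
* **`natCard_layerFiltration_le_of_localKernelBounds`: `#{z ∈ A_n[p] : ν^[m] z = 0} ≤ #{z ∈ Sel_n[p] : ν^[m] z = 0}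
  · ∏_{v ∈ S} C_v^{#R_v}`** — Greenberg's Lemma 3.5 evaluation map restricted to the filtered piece (its kernel
  lies in `Sel_n` AND in the piece), proof verbatim from tower-1's `natCard_layerClasses_le_of_localKernelBounds`;
* `natCard_selmerFiltration_le`: the free lower bound `#{z ∈ Sel_n[p] : …} ≤ #{z ∈ A_n[p] : …}` (`Sel_n ≤ A_n`).
Part 3 (`…TowerFiltrationGap`) assembles the `p = 2` gap certificate `O1.TowerGapAtTwo W` from these.

References: R. Greenberg, LNM 1716 (1999), §1 p. 60 (`X/𝔪X` dual to `Sel[𝔪]`, the `Λ`-action through `Γ`),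
§3 pp. 85–90 (Lemmas 3.1–3.5); L. Washington, *Introduction to Cyclotomic Fields*, §13.1–13.2 (`ω_n`,
Lemma 13.16); J.-P. Serre, *Galois Cohomology*, I.§2.5.
-/
set_option autoImplicit false
-- the Theorems namespace of this sub repeats the summit name by design (D-0017 nested layout: Summit.<S>.<Sub>)
set_option linter.dupNamespace false

noncomputable section

open scoped Classical

open NumberField IsDedekindDomain WeierstrassCurve Literature.NumberTheory.EllipticCurves
  Literature.NumberTheory.EllipticCurves.IwasawaDual PowerSeries Summit.BirchSwinnertonDyer.Rank1Residual
  Summit.BirchSwinnertonDyer.Rank1Residual.X5.TowerGap Summit.BirchSwinnertonDyer.Rank1Residual.X5.O1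

universe u

namespace Summit.BirchSwinnertonDyer.BirchSwinnertonDyer.Theorems.TowerFiltration
/-! ## §2 The layer: `#X/(p, T^m)X` from the `(σ − 1)`-filtration of `A_n[p]`, `m ≤ pⁿ` -/

section Layer

variable {K : Type u} [Field K] [NumberField K] (W : WeierstrassCurve K) [W.IsElliptic] {p : ℕ}
  [hp : Fact p.Prime] (κ : ZpExtension K p) {γ : Field.absoluteGaloisGroup K}

omit [NumberField K] [W.IsElliptic] in
/-- **Restriction intertwines the filtrations**: `h_n ((conj_γ − id)^[m] y) = (conj_γ − id)^[m] (h_n y)` on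
`H¹(K_n, E[p^∞])` (`conjH1_layerToInfty`, iterated). [folklore] -/
theorem layerToInfty_iterate_conjSubId (n m : ℕ) :
    ∀ y : W.subgroupH1 p (κ.layerSubgroup n),
      W.layerToInfty κ n ((⇑(W.conjH1 p (κ.layerSubgroup n) γ -
          AddMonoidHom.id (W.subgroupH1 p (κ.layerSubgroup n))))^[m] y) =
        (⇑(W.conjH1 p κ.kerSubgroup γ - AddMonoidHom.id (W.subgroupH1 p κ.kerSubgroup)))^[m] (W.layerToInfty κ n y) := by
  induction m with
  | zero => intro y; rw [Function.iterate_zero, Function.iterate_zero, id, id]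
  | succ m ih =>
    intro y
    rw [Function.iterate_succ_apply, Function.iterate_succ_apply, ih, AddMonoidHom.sub_apply,
      AddMonoidHom.sub_apply, AddMonoidHom.id_apply, AddMonoidHom.id_apply, map_sub,
      W.layerToInfty_conjH1 κ γ y]

/-- **`{z ∈ A_n[p] : (conj_γ−id)^[m] z = 0} ≃ {s ∈ Sel_∞[p] : (conj_γ−1)^m s = 0}` via `h_n`, for `m ≤ pⁿ`.**
`γ` a topological generator, `E(K)[p] = 0`: `h_n` is injective and intertwines `conj_γ − id`
(`layerToInfty_iterate_conjSubId`); a `p`-torsion class of `Sel_∞` killed by `(conj_γ−1)^m` is fixed by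
`conj_{γ^{pⁿ}}` (§1) hence in the range of `h_n` (the tree's sharp Lemma 3.2,
`ZpExtension.mem_range_resOfLe_of_conjH1_eq`). [cite: GreenbergLNM1716, §3 pp. 85–86 (Lemmas 3.1, 3.2)] -/
theorem natCard_layerFiltration_eq_natCard_filtration (D : W.SelmerDualData κ γ) (hγ : κ.IsTopGenerator γ)
    (hK : ∀ P : W.toAffine.Point, p • P = 0 → P = 0) (n : ℕ) {m : ℕ} (hm : m ≤ p ^ n) :
    Nat.card {z : W.selmerInftyPreimage κ n // p • z = 0 ∧
        (⇑(W.conjH1 p (κ.layerSubgroup n) γ -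
          AddMonoidHom.id (W.subgroupH1 p (κ.layerSubgroup n))))^[m]
          (z : W.subgroupH1 p (κ.layerSubgroup n)) = 0} =
      Nat.card {s : W.selmerInfty κ // p • s = 0 ∧
        ((W.conjSelmerInfty κ γ - 1 : AddMonoid.End (W.selmerInfty κ)) ^ m) s = 0} := by
  let g : {z : W.selmerInftyPreimage κ n // p • z = 0 ∧
        (⇑(W.conjH1 p (κ.layerSubgroup n) γ -
          AddMonoidHom.id (W.subgroupH1 p (κ.layerSubgroup n))))^[m]
          (z : W.subgroupH1 p (κ.layerSubgroup n)) = 0} →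
      {s : W.selmerInfty κ // p • s = 0 ∧
        ((W.conjSelmerInfty κ γ - 1 : AddMonoid.End (W.selmerInfty κ)) ^ m) s = 0} := fun z ↦
    ⟨⟨W.layerToInfty κ n (z.1 : W.subgroupH1 p (κ.layerSubgroup n)), z.1.2⟩, by
      refine ⟨Subtype.ext ?_, Subtype.ext ?_⟩
      · have hz : ((p • z.1 : W.selmerInftyPreimage κ n) : W.subgroupH1 p (κ.layerSubgroup n)) = 0 := by
          rw [z.2.1]; rfl
        change p • W.layerToInfty κ n (z.1 : W.subgroupH1 p (κ.layerSubgroup n)) = 0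
        rw [← map_nsmul, ← AddSubgroup.coe_nsmul, hz, map_zero]
      · rw [coe_conjSelmerInfty_sub_one_pow_apply]
        change (⇑(W.conjH1 p κ.kerSubgroup γ - AddMonoidHom.id (W.subgroupH1 p κ.kerSubgroup)))^[m]
          (W.layerToInfty κ n (z.1 : W.subgroupH1 p (κ.layerSubgroup n))) =
            ((0 : W.selmerInfty κ) : W.subgroupH1 p κ.kerSubgroup)
        rw [← layerToInfty_iterate_conjSubId W κ n m, z.2.2, map_zero]
        rfl⟩
  have hg_coe : ∀ z, (((g z).1 : W.selmerInfty κ) : W.subgroupH1 p κ.kerSubgroup) =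
      W.layerToInfty κ n (z.1 : W.subgroupH1 p (κ.layerSubgroup n)) := fun _ ↦ rfl
  refine Nat.card_congr (Equiv.ofBijective g ⟨?_, ?_⟩)
  · intro z z' h
    have h' := congrArg (fun s ↦ ((s.1 : W.selmerInfty κ) : W.subgroupH1 p κ.kerSubgroup)) h
    simp only [hg_coe] at h'
    exact Subtype.ext (Subtype.ext (Additive.layerToInfty_injective_of_no_pTorsion W κ hK n h'))
  · rintro ⟨s, hps, hνs⟩
    have hfix : W.conjH1 p κ.kerSubgroup (γ ^ p ^ n) (s : W.subgroupH1 p κ.kerSubgroup) = s := by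
      rw [← W.coe_conjSelmerInfty_pow_apply κ γ (p ^ n) s,
        conjSelmerInfty_pow_apply_eq_self_of_filtration D n hm s hps hνs]
    have hprim : ∀ m : geomPrimaryTorsion W p, ∃ k : ℕ, p ^ k • m = 0 := fun m ↦ by
      obtain ⟨k, hk⟩ := m.2
      exact ⟨k, Subtype.ext (by rw [AddSubgroupClass.coe_nsmul, hk, ZeroMemClass.coe_zero])⟩
    obtain ⟨y, hy⟩ : (s : W.subgroupH1 p κ.kerSubgroup) ∈ (W.layerToInfty κ n).range :=
      ZpExtension.mem_range_resOfLe_of_conjH1_eq κ hγ n (W.continuous_smul_geomPrimaryTorsion p)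
        hprim _ hfix
    have hyA : y ∈ W.selmerInftyPreimage κ n := by
      rw [mem_selmerInftyPreimage_iff, hy]; exact s.2
    have hpy : p • (⟨y, hyA⟩ : W.selmerInftyPreimage κ n) = 0 := by
      apply Subtype.ext
      change p • y = 0
      apply Additive.layerToInfty_injective_of_no_pTorsion W κ hK n
      rw [map_nsmul, hy, map_zero, ← AddSubgroup.coe_nsmul, hps, AddSubgroup.coe_zero]
    have hνy : (⇑(W.conjH1 p (κ.layerSubgroup n) γ -
          AddMonoidHom.id (W.subgroupH1 p (κ.layerSubgroup n))))^[m] y = 0 := by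
      apply Additive.layerToInfty_injective_of_no_pTorsion W κ hK n
      rw [layerToInfty_iterate_conjSubId, hy, map_zero, ← coe_conjSelmerInfty_sub_one_pow_apply, hνs]
      rfl
    refine ⟨⟨⟨y, hyA⟩, hpy, hνy⟩, Subtype.ext (Subtype.ext ?_)⟩
    rw [hg_coe]
    exact hy

/-- **THE ONE-LAYER COUNT: `#X/(p, T^m)X = #{z ∈ A_n[p] : (conj_γ − id)^[m] z = 0}` for `m ≤ pⁿ`.**
For an elliptic curve `E = W` over a number field `K` with `E(K)[p] = 0`, ANY `ℤ_p`-extension `κ` with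
topological generator `γ`, any Pontryagin-dual datum `D` over `(κ, γ)` with `X = D.X` finitely generated,
any layer `n` and any `m ≤ pⁿ`. The case `m = pⁿ` is tower-1's
`natCard_quotient_towerIdeal_eq_natCard_layerClasses` (there `(conj_γ−1)^{pⁿ}` kills all of `A_n[p]`).
[cite: GreenbergLNM1716, §1 p. 60, §3 pp. 85–86] -/
theorem natCard_quotient_towerIdeal_eq_natCard_layerFiltration (D : W.SelmerDualData κ γ)
    [Module.Finite (IwasawaAlgebra p) D.X] (hγ : κ.IsTopGenerator γ)
    (hK : ∀ P : W.toAffine.Point, p • P = 0 → P = 0) (n : ℕ) {m : ℕ} (hm : m ≤ p ^ n) :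
    Nat.card (D.X ⧸ (towerIdeal p m • ⊤ : Submodule (IwasawaAlgebra p) D.X)) =
      Nat.card {z : W.selmerInftyPreimage κ n // p • z = 0 ∧
        (⇑(W.conjH1 p (κ.layerSubgroup n) γ -
          AddMonoidHom.id (W.subgroupH1 p (κ.layerSubgroup n))))^[m]
          (z : W.subgroupH1 p (κ.layerSubgroup n)) = 0} := by
  rw [natCard_quotient_towerIdeal_eq_natCard_filtration D m,
    natCard_layerFiltration_eq_natCard_filtration W κ D hγ hK n hm]

end Layer

/-! ## §3 The local error terms and the free lower bound on the filtered pieces -/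

section Local

variable {K : Type u} [Field K] [NumberField K] (W : WeierstrassCurve K) {p : ℕ} [hp : Fact p.Prime]
  (κ : ZpExtension K p) {γ : Field.absoluteGaloisGroup K}

/-- **`#{z ∈ A_n[p] : ν^[m] z = 0} ≤ #{z ∈ Sel_{p^∞}(E/K_n)[p] : ν^[m] z = 0} · ∏_{v ∈ S} C_v ^ #R_v`**,
`ν = conj_γ − id` (Greenberg's Lemma 3.5 evaluation map restricted to the filtered piece of `A_n[p]`: its
kernel lies in `Sel_n` — tree `mem_selmerLayer_of_forall_localResOver_conjH1_eq_zero` — AND in the same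
filtered piece, and its values are `p`-torsion classes of the local tower kernels). Proof verbatim from
tower-1's `natCard_layerClasses_le_of_localKernelBounds` with `A_n[p]` replaced by the piece.
[cite: GreenbergLNM1716, §3 Lemma 3.5 (proof, p. 90)] -/
theorem natCard_layerFiltration_le_of_localKernelBounds {n m : ℕ}
    (S : Finset (HeightOneSpectrum (𝓞 K))) (C : HeightOneSpectrum (𝓞 K) → ℕ)
    (R : HeightOneSpectrum (𝓞 K) → Finset (Field.absoluteGaloisGroup K))
    (h0 : ∀ v ∉ S, W.localTowerKerPrimary κ (v.adicCompletion K) n = ⊥)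
    (hC : ∀ v ∈ S, Finite {x : W.localTowerKerPrimary κ (v.adicCompletion K) n // p • x = 0} ∧
      Nat.card {x : W.localTowerKerPrimary κ (v.adicCompletion K) n // p • x = 0} ≤ C v)
    (hR : ∀ v ∈ S, ∀ σ : Field.absoluteGaloisGroup K, ∃ ρ ∈ R v,
      ∃ δ : Field.absoluteGaloisGroup (v.adicCompletion K), ∃ τ ∈ κ.layerSubgroup n,
        σ = resGal (K := K) (v.adicCompletion K) δ * ρ * τ)
    (hfin : Finite {z : W.selmerLayer κ n // p • z = 0 ∧
      (⇑(W.conjH1 p (κ.layerSubgroup n) γ -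
          AddMonoidHom.id (W.subgroupH1 p (κ.layerSubgroup n))))^[m]
        (z : W.subgroupH1 p (κ.layerSubgroup n)) = 0}) :
    Nat.card {z : W.selmerInftyPreimage κ n // p • z = 0 ∧
        (⇑(W.conjH1 p (κ.layerSubgroup n) γ -
          AddMonoidHom.id (W.subgroupH1 p (κ.layerSubgroup n))))^[m]
          (z : W.subgroupH1 p (κ.layerSubgroup n)) = 0} ≤
      Nat.card {z : W.selmerLayer κ n // p • z = 0 ∧
        (⇑(W.conjH1 p (κ.layerSubgroup n) γ -
          AddMonoidHom.id (W.subgroupH1 p (κ.layerSubgroup n))))^[m]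
          (z : W.subgroupH1 p (κ.layerSubgroup n)) = 0} * ∏ v ∈ S, C v ^ (R v).card := by
  set ν : W.subgroupH1 p (κ.layerSubgroup n) →+ W.subgroupH1 p (κ.layerSubgroup n) :=
    W.conjH1 p (κ.layerSubgroup n) γ - AddMonoidHom.id (W.subgroupH1 p (κ.layerSubgroup n)) with hν
  set A := W.selmerInftyPreimage κ n with hA
  set I : Finset ((_ : HeightOneSpectrum (𝓞 K)) × Field.absoluteGaloisGroup K) :=
    S.sigma fun v ↦ R v with hI
  have hIv : ∀ i : ↥I, i.1.1 ∈ S := fun i ↦ (Finset.mem_sigma.mp i.2).1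
  -- the evaluation map on `A_n`
  let Φ : ↥A →+ (Π i : ↥I, discreteH1 (localSubgroup (κ.layerSubgroup n) (i.1.1.adicCompletion K))
      (localPoints W (i.1.1.adicCompletion K))) :=
    AddMonoidHom.pi fun i ↦
      ((W.localResOver p (κ.layerSubgroup n) (i.1.1.adicCompletion K)).comp
        (W.conjH1 p (κ.layerSubgroup n) i.1.2)).comp A.subtype
  have hΦ : ∀ (y : ↥A) (i : ↥I), Φ y i = W.localResOver p (κ.layerSubgroup n)
      (i.1.1.adicCompletion K) (W.conjH1 p (κ.layerSubgroup n) i.1.2 (y : W.subgroupH1 p _)) :=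
    fun y i ↦ rfl
  -- restricted to the filtered piece `P = {z ∈ A_n[p] : ν^[m] z = 0}`
  let P : AddSubgroup ↥A :=
    { carrier := {z | p • z = 0 ∧ (⇑ν)^[m] (z : W.subgroupH1 p (κ.layerSubgroup n)) = 0}
      zero_mem' := ⟨smul_zero _, by
        change (⇑ν)^[m] (0 : W.subgroupH1 p (κ.layerSubgroup n)) = 0
        exact iterate_map_zero ν m⟩
      add_mem' := by
        rintro a b ⟨ha, ha'⟩ ⟨hb, hb'⟩
        exact ⟨by rw [smul_add, ha, hb, add_zero], by
          change (⇑ν)^[m] ((a : W.subgroupH1 p (κ.layerSubgroup n)) + b) = 0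
          rw [iterate_map_add, ha', hb', add_zero]⟩
      neg_mem' := by
        rintro a ⟨ha, ha'⟩
        exact ⟨by rw [smul_neg, ha, neg_zero], by
          change (⇑ν)^[m] (-(a : W.subgroupH1 p (κ.layerSubgroup n))) = 0
          rw [iterate_map_neg, ha', neg_zero]⟩ }
  have hPmem : ∀ z : ↥A, z ∈ P ↔
      p • z = 0 ∧ (⇑ν)^[m] (z : W.subgroupH1 p (κ.layerSubgroup n)) = 0 := fun z ↦ Iff.rfl
  have hPcoe : ∀ z : ↥P, p • ((z : ↥A) : W.subgroupH1 p (κ.layerSubgroup n)) = 0 := fun z ↦ by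
    rw [← AddSubgroup.coe_nsmul, ((hPmem _).mp z.2).1, AddSubgroup.coe_zero]
  have hPν : ∀ z : ↥P, (⇑ν)^[m] ((z : ↥A) : W.subgroupH1 p (κ.layerSubgroup n)) = 0 := fun z ↦
    ((hPmem _).mp z.2).2
  let ΦP : ↥P →+ _ := Φ.comp P.subtype
  have hΦP : ∀ z : ↥P, ΦP z = Φ (z : ↥A) := fun _ ↦ rfl
  -- (1) the kernel lies in the filtered piece of `Sel_n[p]`
  have hker_sel : ∀ z : ↥P, ΦP z = 0 →
      ((z : ↥A) : W.subgroupH1 p (κ.layerSubgroup n)) ∈ W.selmerLayer κ n := by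
    intro z hz
    refine W.mem_selmerLayer_of_forall_localResOver_conjH1_eq_zero κ S h0 R
      (fun v hv σ ↦ hR v hv σ) (z : ↥A).2 fun v hv ρ hρ ↦ ?_
    have := congrFun hz ⟨⟨v, ρ⟩, Finset.mem_sigma.mpr ⟨hv, hρ⟩⟩
    rw [hΦP, hΦ] at this
    exact this
  let kerToSel : ↥ΦP.ker → {z : W.selmerLayer κ n // p • z = 0 ∧
      (⇑ν)^[m] (z : W.subgroupH1 p (κ.layerSubgroup n)) = 0} := fun z ↦
    ⟨⟨((z.1 : ↥A) : W.subgroupH1 p (κ.layerSubgroup n)), hker_sel z.1 z.2⟩,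
      TowerLayer.nsmul_mk_eq_zero _ _ (hPcoe z.1), hPν z.1⟩
  have hkerToSel_val : ∀ z : ↥ΦP.ker,
      (((kerToSel z).1 : ↥(W.selmerLayer κ n)) : W.subgroupH1 p (κ.layerSubgroup n)) =
        ((z.1 : ↥A) : W.subgroupH1 p (κ.layerSubgroup n)) := fun _ ↦ rfl
  have hkerToSel : Function.Injective kerToSel := by
    intro z z' h
    have h' : (((kerToSel z).1 : ↥(W.selmerLayer κ n)) : W.subgroupH1 p (κ.layerSubgroup n)) =
        (((kerToSel z').1 : ↥(W.selmerLayer κ n)) : W.subgroupH1 p (κ.layerSubgroup n)) := by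
      rw [h]
    rw [hkerToSel_val, hkerToSel_val] at h'
    exact Subtype.ext (Subtype.ext (Subtype.ext h'))
  -- (2) the values are `p`-torsion classes of the local tower kernels
  have hval : ∀ (z : ↥P) (i : ↥I),
      ΦP z i ∈ W.localTowerKerPrimary κ (i.1.1.adicCompletion K) n ∧ p • ΦP z i = 0 := by
    intro z i
    have hpz : p • ΦP z i = 0 := by
      rw [hΦP, hΦ, ← map_nsmul, ← map_nsmul, hPcoe z, map_zero, map_zero]
    exact ⟨⟨by rw [hΦP, hΦ]; exact W.localResOver_conjH1_mem_localTowerKer_of_mem κ (z : ↥A).2 _ _,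
      1, by rw [pow_one]; exact hpz⟩, hpz⟩
  haveI hfinK : ∀ i : ↥I,
      Finite {x : W.localTowerKerPrimary κ (i.1.1.adicCompletion K) n // p • x = 0} :=
    fun i ↦ (hC _ (hIv i)).1
  have hval' : ∀ (x : ΦP.range) (i : ↥I),
      x.1 i ∈ W.localTowerKerPrimary κ (i.1.1.adicCompletion K) n ∧ p • x.1 i = 0 := by
    rintro ⟨x, z, rfl⟩ i
    exact hval z i
  let g : ΦP.range → Π i : ↥I,
      {x : W.localTowerKerPrimary κ (i.1.1.adicCompletion K) n // p • x = 0} := fun x i ↦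
    ⟨⟨x.1 i, (hval' x i).1⟩, TowerLayer.nsmul_mk_eq_zero _ _ (hval' x i).2⟩
  have hg_val : ∀ (x : ΦP.range) (i : ↥I),
      (((g x i).1 : W.localTowerKerPrimary κ (i.1.1.adicCompletion K) n) :
        discreteH1 (localSubgroup (κ.layerSubgroup n) (i.1.1.adicCompletion K))
          (localPoints W (i.1.1.adicCompletion K))) = x.1 i := fun _ _ ↦ rfl
  have hg : Function.Injective g := by
    intro x x' h
    refine Subtype.ext (funext fun i ↦ ?_)
    rw [← hg_val x i, ← hg_val x' i, h]
  haveI : Finite ΦP.range := Finite.of_injective g hg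
  have hcard_range : Nat.card ΦP.range ≤ ∏ v ∈ S, C v ^ (R v).card :=
    calc Nat.card ΦP.range
        ≤ Nat.card (Π i : ↥I,
            {x : W.localTowerKerPrimary κ (i.1.1.adicCompletion K) n // p • x = 0}) :=
          Nat.card_le_card_of_injective g hg
      _ = ∏ i : ↥I, Nat.card
            {x : W.localTowerKerPrimary κ (i.1.1.adicCompletion K) n // p • x = 0} := Nat.card_pi
      _ ≤ ∏ i : ↥I, C i.1.1 :=
          Finset.prod_le_prod (fun i _ ↦ Nat.zero_le _) fun i _ ↦ (hC _ (hIv i)).2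
      _ = ∏ i ∈ I, C i.1 := Finset.prod_coe_sort I (fun i ↦ C i.1)
      _ = ∏ v ∈ S, ∏ ρ ∈ R v, C v := Finset.prod_sigma S (fun v ↦ R v) (fun i ↦ C i.1)
      _ = ∏ v ∈ S, C v ^ (R v).card := Finset.prod_congr rfl fun v _ ↦ Finset.prod_const (C v)
  -- (3) count
  haveI : Finite ΦP.ker := Finite.of_injective kerToSel hkerToSel
  have hP : Nat.card ↥P = Nat.card (↥P ⧸ ΦP.ker) * Nat.card ΦP.ker :=
    AddSubgroup.card_eq_card_quotient_mul_card_addSubgroup _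
  have hq : Nat.card (↥P ⧸ ΦP.ker) = Nat.card ΦP.range :=
    Nat.card_congr (QuotientAddGroup.quotientKerEquivRange ΦP).toEquiv
  have hker_le : Nat.card ΦP.ker ≤ Nat.card {z : W.selmerLayer κ n // p • z = 0 ∧
      (⇑ν)^[m] (z : W.subgroupH1 p (κ.layerSubgroup n)) = 0} :=
    Nat.card_le_card_of_injective kerToSel hkerToSel
  have hPA : Nat.card {z : W.selmerInftyPreimage κ n // p • z = 0 ∧
      (⇑ν)^[m] (z : W.subgroupH1 p (κ.layerSubgroup n)) = 0} = Nat.card ↥P :=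
    Nat.card_congr (Equiv.subtypeEquivRight fun z ↦ (hPmem z).symm)
  rw [hPA, hP, hq, mul_comm]
  exact Nat.mul_le_mul hker_le hcard_range

/-- **The free lower bound: `#{z ∈ Sel_n[p] : ν^[m] z = 0} ≤ #{z ∈ A_n[p] : ν^[m] z = 0}`** (`Sel_n ≤ A_n`,
tree `selmerLayer_le_selmerInftyPreimage`; the condition is computed in the common ambient group), when the
target is finite. [cite: GreenbergLNM1716, §3 pp. 85–86] -/
theorem natCard_selmerFiltration_le {n m : ℕ}
    (hfin : Finite {z : W.selmerInftyPreimage κ n // p • z = 0 ∧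
      (⇑(W.conjH1 p (κ.layerSubgroup n) γ -
          AddMonoidHom.id (W.subgroupH1 p (κ.layerSubgroup n))))^[m]
        (z : W.subgroupH1 p (κ.layerSubgroup n)) = 0}) :
    Nat.card {z : W.selmerLayer κ n // p • z = 0 ∧
        (⇑(W.conjH1 p (κ.layerSubgroup n) γ -
          AddMonoidHom.id (W.subgroupH1 p (κ.layerSubgroup n))))^[m]
          (z : W.subgroupH1 p (κ.layerSubgroup n)) = 0} ≤
      Nat.card {z : W.selmerInftyPreimage κ n // p • z = 0 ∧
        (⇑(W.conjH1 p (κ.layerSubgroup n) γ -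
          AddMonoidHom.id (W.subgroupH1 p (κ.layerSubgroup n))))^[m]
          (z : W.subgroupH1 p (κ.layerSubgroup n)) = 0} := by
  have hle := W.selmerLayer_le_selmerInftyPreimage κ n
  let f : {z : W.selmerLayer κ n // p • z = 0 ∧
        (⇑(W.conjH1 p (κ.layerSubgroup n) γ -
          AddMonoidHom.id (W.subgroupH1 p (κ.layerSubgroup n))))^[m]
          (z : W.subgroupH1 p (κ.layerSubgroup n)) = 0} →
      {z : W.selmerInftyPreimage κ n // p • z = 0 ∧
        (⇑(W.conjH1 p (κ.layerSubgroup n) γ -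
          AddMonoidHom.id (W.subgroupH1 p (κ.layerSubgroup n))))^[m]
          (z : W.subgroupH1 p (κ.layerSubgroup n)) = 0} :=
    fun z ↦ ⟨AddSubgroup.inclusion hle z.1, by rw [← map_nsmul, z.2.1, map_zero], z.2.2⟩
  have hf : Function.Injective f := by
    intro z z' h
    have h' := congrArg (fun w : {z : W.selmerInftyPreimage κ n // p • z = 0 ∧
        (⇑(W.conjH1 p (κ.layerSubgroup n) γ -
          AddMonoidHom.id (W.subgroupH1 p (κ.layerSubgroup n))))^[m]
          (z : W.subgroupH1 p (κ.layerSubgroup n)) = 0} ↦ w.1) h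
    exact Subtype.ext (AddSubgroup.inclusion_injective hle h')
  exact Nat.card_le_card_of_injective f hf

end Local

end Summit.BirchSwinnertonDyer.BirchSwinnertonDyer.Theorems.TowerFiltration

end
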